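import Mathlib
import HarnessLib
import Literature.Dynamics.TopologicalDynamics.UniformRecurrence
import Literature.Analysis.FluidPDE.BarkerPrange2020VorticityAlignmentTypeIHolds
import Summits.NavierStokesRegularity.NavierStokesRegularity.Theorems.PoloidalWindowDoorPoloidalWindowRigidityHotHullSlabUniform

/-!
# Route `PoloidalWindowDoor`, crux `PoloidalWindowRigidity` (K2, stmt-NavierStokesRegularity-19708) — THICK column infrastructure:
# BIRKHOFF RECURRENCE for a continuous `ℝ`-action on a compact hull of class profiles, with an observable (generic wrapper)

Cell ns-regularity-ideate, seat ns-poloidal-K2-p2 g14.  ONE statement covering the two recurrence steps landed tonight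
(`…HotHullRecurrence.exists_uniformly_recurrent` — sliding along leaves, observable = vorticity slice at `−1`; `…EternalCoreScalingRecurrence.exists_scaling_recurrent`
— parabolic rescalings, no observable) and meant to be CONSUMED BY NAME by future lines of the column that need «a uniformly recurrent member of a compact,
action-invariant family of Type-I ancient mild profiles»:

`exists_recurrent_of_action`: let `Ω ⊆ A_C` be non-empty, `obs : profile ↦ (ℝ³ → ℝ³)` an observable continuous on members, `Ω` SEQUENTIALLY COMPACT AND CLOSED
for (slice-wise locally uniform convergence of all slices `t < 0`) ∧ (locally uniform convergence of `obs`), and `Φ : ℝ → profile → profile` an action that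
preserves `Ω`, satisfies `Φ (s + t) = Φ s ∘ Φ t` on `Ω`, and is SEQUENTIALLY CONTINUOUS on `Ω` for that convergence.  Then some `U ∈ Ω` is UNIFORMLY RECURRENT:
for every `ε > 0` and every slab index `n` the set of `σ` with `Φ σ U` `ε`-close to `U` on `[−(n+2), −(n+2)⁻¹] × B̄_{n+2}` and `obs (Φ σ U)` `ε`-close to `obs U`
on `B̄_{n+2}` is relatively dense in `ℝ`.

PROOF: phase space `X := Ω` with the uniform structure pulled back along `Ψ : U ↦ (n ↦ ((t,x) ↦ (U t x, obs U x))|_{slab n}) ∈ Π n, C(slab n, ℝ³ × ℝ³)`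
(countably generated ⇒ pseudo-metrisable ⇒ `IsSeqCompact.isCompact`, `continuous_iff_seqContinuous`); convergence in `X` ⇔ the hull convergence by the
class-uniform KNSS moduli `…HotHullSlabUniform.tendstoUniformlyOn_slab`; then the tree's Birkhoff–Furstenberg `exists_isUniformlyRecurrentPt` and
`isSyndetic_iff_exists_window`.

WHAT THIS IS NOT: not a claim about Navier–Stokes regularity — topological-dynamics infrastructure for the supports of the THICK column of a door route
(bears_on LADDER-NS N0, rung N0-LocalTubeDoorPoloidal); research cells OPEN; crux 19708 / item 20428 OPEN; NS regularity NOT proved.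
-/

noncomputable section

-- the summit and its single sub-problem share the name (CONVENTIONS §1), as in every Theorems file
set_option linter.dupNamespace false

namespace Summit.NavierStokesRegularity.NavierStokesRegularity.Theorems.PoloidalWindowDoorPoloidalWindowRigidityHullBirkhoff

open Set Function Filter Topology Metric
open scoped NNReal Uniformity Topology
open Literature.Analysis Literature.Analysis.FluidPDE Literature.Analysis.UnboundedOperators
open Literature.Dynamics.TopologicalDynamics
open Summit.NavierStokesRegularity.NavierStokesRegularity.Theorems
open PoloidalWindowDoorPoloidalWindowRigidityHotHullSlabUniform

/-- **Birkhoff recurrence for a continuous `ℝ`-action on a compact hull of class profiles, with an observable.**  See the module docstring. -/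
theorem exists_recurrent_of_action (C : ℝ) (Ω : Set (ℝ → EuclideanSpace ℝ (Fin 3) → EuclideanSpace ℝ (Fin 3))) (hne : Ω.Nonempty)
    (hcls : ∀ U ∈ Ω, IsTypeIAncientMild C U)
    (obs : (ℝ → EuclideanSpace ℝ (Fin 3) → EuclideanSpace ℝ (Fin 3)) → EuclideanSpace ℝ (Fin 3) → EuclideanSpace ℝ (Fin 3))
    (hobs : ∀ U ∈ Ω, Continuous (obs U))
    (hcpt : ∀ Us : ℕ → ℝ → EuclideanSpace ℝ (Fin 3) → EuclideanSpace ℝ (Fin 3), (∀ k, Us k ∈ Ω) →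
      ∃ (φ : ℕ → ℕ) (U : ℝ → EuclideanSpace ℝ (Fin 3) → EuclideanSpace ℝ (Fin 3)), StrictMono φ ∧ U ∈ Ω ∧
        (∀ t < 0, TendstoLocallyUniformly (fun j => Us (φ j) t) (U t) atTop) ∧
        TendstoLocallyUniformly (fun j => obs (Us (φ j))) (obs U) atTop)
    (Φ : ℝ → (ℝ → EuclideanSpace ℝ (Fin 3) → EuclideanSpace ℝ (Fin 3)) → (ℝ → EuclideanSpace ℝ (Fin 3) → EuclideanSpace ℝ (Fin 3)))
    (hinv : ∀ U ∈ Ω, ∀ σ : ℝ, Φ σ U ∈ Ω) (hadd : ∀ U ∈ Ω, ∀ s t : ℝ, Φ (s + t) U = Φ s (Φ t U))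
    (hcont : ∀ σ : ℝ, ∀ (Us : ℕ → ℝ → EuclideanSpace ℝ (Fin 3) → EuclideanSpace ℝ (Fin 3)) (U : ℝ → EuclideanSpace ℝ (Fin 3) → EuclideanSpace ℝ (Fin 3)),
      (∀ k, Us k ∈ Ω) → U ∈ Ω → (∀ t < 0, TendstoLocallyUniformly (fun k => Us k t) (U t) atTop) →
      TendstoLocallyUniformly (fun k => obs (Us k)) (obs U) atTop →
      (∀ t < 0, TendstoLocallyUniformly (fun k => Φ σ (Us k) t) (Φ σ U t) atTop) ∧
        TendstoLocallyUniformly (fun k => obs (Φ σ (Us k))) (obs (Φ σ U)) atTop) :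
    ∃ U ∈ Ω, ∀ ε : ℝ, 0 < ε → ∀ n : ℕ, ∃ L : ℝ, 0 < L ∧ ∀ a : ℝ, ∃ σ ∈ Icc a (a + L),
      (∀ t ∈ Icc (-((n : ℝ) + 2)) (-((n : ℝ) + 2)⁻¹), ∀ x ∈ closedBall (0 : EuclideanSpace ℝ (Fin 3)) ((n : ℝ) + 2),
        dist (Φ σ U t x) (U t x) < ε) ∧
      (∀ x ∈ closedBall (0 : EuclideanSpace ℝ (Fin 3)) ((n : ℝ) + 2), dist (obs (Φ σ U) x) (obs U x) < ε) := by
  classical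
  have hslice : ∀ U ∈ Ω, ∀ t < 0, Continuous (U t) := fun U hU t ht => ((hcls U hU).analyticOnNhd_slice_univ ht).continuous
  -- the phase space and the action
  let X := {U : ℝ → EuclideanSpace ℝ (Fin 3) → EuclideanSpace ℝ (Fin 3) // U ∈ Ω}
  let ϕ : ℝ → X → X := fun σ U => ⟨Φ σ U.1, hinv U.1 U.2 σ⟩
  have haddX : ∀ s t (U : X), ϕ (s + t) U = ϕ s (ϕ t U) := fun s t U => Subtype.ext (hadd U.1 U.2 s t)
  -- the compact slabs and the embedding `Ψ`
  let Sn : ℕ → Set (ℝ × EuclideanSpace ℝ (Fin 3)) := fun n =>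
    Icc (-((n : ℝ) + 2)) (-((n : ℝ) + 2)⁻¹) ×ˢ closedBall (0 : EuclideanSpace ℝ (Fin 3)) ((n : ℝ) + 2)
  have hSnc : ∀ n, IsCompact (Sn n) := fun n => isCompact_Icc.prod (isCompact_closedBall _ _)
  haveI hSncs : ∀ n, CompactSpace (Sn n) := fun n => isCompact_iff_compactSpace.1 (hSnc n)
  have hn2 : ∀ n : ℕ, (1 : ℝ) ≤ (n : ℝ) + 2 := fun n => by have := n.cast_nonneg (α := ℝ); linarith
  have hSn_neg : ∀ n, ∀ p ∈ Sn n, p.1 < 0 := fun n p hp => by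
    have h1 : p.1 ≤ -((n : ℝ) + 2)⁻¹ := (mem_prod.1 hp).1.2
    have h2 : (0 : ℝ) < ((n : ℝ) + 2)⁻¹ := by positivity
    linarith
  have hm1 : ∀ n : ℕ, (-1 : ℝ) ∈ Icc (-((n : ℝ) + 2)) (-((n : ℝ) + 2)⁻¹) := fun n =>
    ⟨by linarith [hn2 n], by rw [neg_le_neg_iff]; exact inv_le_one_of_one_le₀ (hn2 n)⟩
  have hΨc : ∀ (U : X) (n : ℕ), Continuous fun p : Sn n => (U.1 p.1.1 p.1.2, obs U.1 p.1.2) := fun U n => by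
    refine Continuous.prodMk ?_ ((hobs U.1 U.2).comp (continuous_snd.comp continuous_subtype_val))
    exact (hcls U.1 U.2).continuousOn_uncurry.comp_continuous continuous_subtype_val fun p => ⟨hSn_neg n p.1 p.2, mem_univ _⟩
  let Ψ : X → ((n : ℕ) → C(Sn n, EuclideanSpace ℝ (Fin 3) × EuclideanSpace ℝ (Fin 3))) := fun U n =>
    ⟨fun p => (U.1 p.1.1 p.1.2, obs U.1 p.1.2), hΨc U n⟩
  -- the phase-space topology: pulled back along `Ψ`
  letI uX : UniformSpace X := UniformSpace.comap Ψ inferInstance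
  letI tX : TopologicalSpace X := uX.toTopologicalSpace
  haveI hcg : IsCountablyGenerated (𝓤 X) := by
    show IsCountablyGenerated 𝓤[UniformSpace.comap Ψ inferInstance]
    rw [uniformity_comap]
    infer_instance
  haveI : TopologicalSpace.PseudoMetrizableSpace X := inferInstance
  haveI : Nonempty X := ⟨⟨hne.some, hne.some_mem⟩⟩
  have hΨind : Topology.IsInducing Ψ := ⟨rfl⟩
  have hconvX : ∀ {Us : ℕ → X} {U : X}, Tendsto Us atTop (𝓝 U) ↔
      ∀ n, TendstoUniformly (fun k (p : Sn n) => Ψ (Us k) n p) (Ψ U n) atTop := by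
    intro Us U
    rw [hΨind.tendsto_nhds_iff, tendsto_pi_nhds]
    exact forall_congr' fun n => ContinuousMap.tendsto_iff_tendstoUniformly
  have hX_to_hull : ∀ {Us : ℕ → X} {U : X}, Tendsto Us atTop (𝓝 U) →
      (∀ t < 0, TendstoLocallyUniformly (fun k => (Us k).1 t) (U.1 t) atTop) ∧
      TendstoLocallyUniformly (fun k => obs (Us k).1) (obs U.1) atTop := by
    intro Us U h
    rw [hconvX] at h
    constructor
    · intro t ht
      rw [tendstoLocallyUniformly_iff_forall_isCompact]
      intro Kc hKc
      obtain ⟨r, hr⟩ := hKc.isBounded.subset_closedBall 0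
      obtain ⟨n, hn⟩ := exists_nat_ge (max (max r (-t)) (-t)⁻¹)
      have hnr : r ≤ (n : ℝ) + 2 := by linarith [le_max_left (max r (-t)) (-t)⁻¹, le_max_left r (-t)]
      have ht1 : -((n : ℝ) + 2) ≤ t := by linarith [le_max_left (max r (-t)) (-t)⁻¹, le_max_right r (-t)]
      have ht2 : t ≤ -((n : ℝ) + 2)⁻¹ := by
        have h1 : (-t)⁻¹ ≤ (n : ℝ) + 2 := by linarith [le_max_right (max r (-t)) (-t)⁻¹]
        have h2 : ((n : ℝ) + 2)⁻¹ ≤ -t := inv_le_of_inv_le₀ (by linarith) h1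
        linarith
      rw [Metric.tendstoUniformlyOn_iff]
      intro ε hε
      filter_upwards [Metric.tendstoUniformly_iff.1 (h n) ε hε] with k hk x hx
      have hp : (t, x) ∈ Sn n := mem_prod.2 ⟨⟨ht1, ht2⟩, closedBall_subset_closedBall hnr (hr hx)⟩
      have h1 := hk ⟨(t, x), hp⟩
      rw [Prod.dist_eq, max_lt_iff] at h1
      exact h1.1
    · rw [tendstoLocallyUniformly_iff_forall_isCompact]
      intro Kc hKc
      obtain ⟨r, hr⟩ := hKc.isBounded.subset_closedBall 0
      obtain ⟨n, hn⟩ := exists_nat_ge r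
      have hnr : r ≤ (n : ℝ) + 2 := by linarith
      rw [Metric.tendstoUniformlyOn_iff]
      intro ε hε
      filter_upwards [Metric.tendstoUniformly_iff.1 (h n) ε hε] with k hk x hx
      have hp : ((-1 : ℝ), x) ∈ Sn n := mem_prod.2 ⟨hm1 n, closedBall_subset_closedBall hnr (hr hx)⟩
      have h1 := hk ⟨((-1 : ℝ), x), hp⟩
      rw [Prod.dist_eq, max_lt_iff] at h1
      exact h1.2
  have hhull_to_X : ∀ {Us : ℕ → X} {U : X}, (∀ t < 0, TendstoLocallyUniformly (fun k => (Us k).1 t) (U.1 t) atTop) →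
      TendstoLocallyUniformly (fun k => obs (Us k).1) (obs U.1) atTop → Tendsto Us atTop (𝓝 U) := by
    intro Us U hsl hcu
    rw [hconvX]
    intro n
    have hslab := tendstoUniformlyOn_slab C (u := fun k => (Us k).1) (U := U.1) (fun k => (hcls _ (Us k).2).hasTypeITimeDecay)
      (fun k => (hcls _ (Us k).2).continuousOn_uncurry) (fun k s t hst ht x => (hcls _ (Us k).2).mild_eq_heatExtension hst ht x)
      (fun k t ht => (hcls _ (Us k).2).isDivFree ht) (hcls _ U.2).hasTypeITimeDecay (hcls _ U.2).continuousOn_uncurry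
      (fun s t hst ht x => (hcls _ U.2).mild_eq_heatExtension hst ht x) (fun t ht => (hcls _ U.2).isDivFree ht)
      (fun t ht x => (hsl t ht).tendsto_comp ((hslice _ U.2 t ht).continuousAt) tendsto_const_nhds) (hn2 n)
    have hcurlU := (tendstoLocallyUniformly_iff_forall_isCompact.1 hcu) _ (isCompact_closedBall (0 : EuclideanSpace ℝ (Fin 3)) ((n : ℝ) + 2))
    rw [Metric.tendstoUniformly_iff]
    intro ε hε
    filter_upwards [Metric.tendstoUniformlyOn_iff.1 hslab ε hε, Metric.tendstoUniformlyOn_iff.1 hcurlU ε hε] with k hk1 hk2 p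
    rw [Prod.dist_eq, max_lt_iff]
    exact ⟨hk1 p.1 p.2, hk2 p.1.2 (mem_prod.1 p.2).2⟩
  -- compactness and continuity
  have hseq : IsSeqCompact (univ : Set X) := by
    intro Us _
    obtain ⟨φ, U, hφ, hUΩ, hsl, hcu⟩ := hcpt (fun k => (Us k).1) (fun k => (Us k).2)
    exact ⟨⟨U, hUΩ⟩, mem_univ _, φ, hφ, hhull_to_X (Us := Us ∘ φ) (U := ⟨U, hUΩ⟩) hsl hcu⟩
  have hcompact : IsCompact (univ : Set X) := hseq.isCompact
  have hcontϕ : ∀ σ, Continuous (ϕ σ) := by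
    intro σ
    refine continuous_iff_seqContinuous.2 fun Us U h => ?_
    obtain ⟨hsl, hcu⟩ := hX_to_hull h
    obtain ⟨h1, h2⟩ := hcont σ (fun k => (Us k).1) U.1 (fun k => (Us k).2) U.2 hsl hcu
    exact hhull_to_X (Us := fun k => ϕ σ (Us k)) (U := ϕ σ U) h1 h2
  -- Birkhoff–Furstenberg
  obtain ⟨Ustar, -, hrec⟩ := exists_isUniformlyRecurrentPt (G := ℝ) (ϕ := ϕ) hcontϕ haddX hcompact univ_nonempty
    (fun σ => mapsTo_univ _ _)
  refine ⟨Ustar.1, Ustar.2, fun ε hε n => ?_⟩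
  set N : Set X := Ψ ⁻¹' {y | y n ∈ ball (Ψ Ustar n) ε} with hN
  have hNo : IsOpen N := (isOpen_ball.preimage (continuous_apply n)).preimage hΨind.continuous
  have hNmem : Ustar ∈ N := by
    show Ψ Ustar n ∈ ball (Ψ Ustar n) ε
    exact mem_ball_self hε
  obtain ⟨L, hL, hwin⟩ := isSyndetic_iff_exists_window.1 (hrec N (hNo.mem_nhds hNmem))
  refine ⟨L, hL, fun a => ?_⟩
  obtain ⟨σ, hσ, hσN⟩ := hwin a
  have hd : dist (Ψ (ϕ σ Ustar) n) (Ψ Ustar n) < ε := by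
    have : Ψ (ϕ σ Ustar) n ∈ ball (Ψ Ustar n) ε := hσN
    exact mem_ball.1 this
  have hpt : ∀ p : Sn n, dist ((Ψ (ϕ σ Ustar) n) p) ((Ψ Ustar n) p) < ε := fun p =>
    (ContinuousMap.dist_apply_le_dist p).trans_lt hd
  refine ⟨σ, hσ, fun t ht x hx => ?_, fun x hx => ?_⟩
  · have h := hpt ⟨(t, x), mem_prod.2 ⟨ht, hx⟩⟩
    rw [Prod.dist_eq, max_lt_iff] at h
    exact h.1
  · have h := hpt ⟨((-1 : ℝ), x), mem_prod.2 ⟨hm1 n, hx⟩⟩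
    rw [Prod.dist_eq, max_lt_iff] at h
    exact h.2

end Summit.NavierStokesRegularity.NavierStokesRegularity.Theorems.PoloidalWindowDoorPoloidalWindowRigidityHullBirkhoff

end
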